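import Literature.MathematicalPhysics.QuantumFieldTheory.Balaban1983to89.B8Prop5ContractionKLevel

/-!
# `Balaban1983to89.B8Prop5ContractionKLevelSanity` — NON-VACUITY GUARD for `B8Prop5ContractionKLevel.propFive_fixedPoint_kLevel`
# ([Balaban1985RegularSpaces] Sect. D, Proposition 5's contraction at `k` levels): the binder list is jointly satisfiable

statement-level skeleton of published theorems with citation tags; proofs where landed; nothing here is a claim about the
Yang–Mills mass gap

WHY THIS FILE (cell `pub-ymgap`, REBALANCE №41-b, seat `pub-ymgap-dag-n19-b` g2; referee hygiene A5/A6).  `propFive_fixedPoint_kLevel`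
(p427248) concludes `∃! s, ‖s‖ ≤ ¼α₄ ∧ λ_s = G′(Ψ λ_s)` under ≈ 25 displayed hypotheses (letters `G′`, `R`; maps `gpar`, `Eterm`; datum sizes;
windows; (1.103)/(1.106)-smallness).  This file instantiates ALL of them at once on trivial data — `G′ = R = 0`, `gpar = Eterm = 0`, `D*A = 0`,
`A = 0`, `b₁ = 1/140`, every other constant `0`, `α₄ = 1` — so the hypothesis set is consistent and the theorem FIRES (the unique fixed point
is `λ = 0`).  It proves nothing about Bałaban's objects.

WHAT IS PROVED (kernel, 0 sorry, theorems only): `propFive_fixedPoint_kLevel_nonvacuous` — the conclusion of `propFive_fixedPoint_kLevel` at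
the trivial datum; `trivial_fixedPoint_eq_zero` — there the fixed point is `0`.
Count-neutral; N05 NOT discharged; nothing continuum / ℝ⁴ / OS / mass-gap / Clay.  Unit `pub-ymgap-dag-n19-b` (g2), 2026-08-26.
-/

noncomputable section

open NormedSpace Metric Set

namespace Literature.MathematicalPhysics.QuantumFieldTheory.Balaban1983to89.B8Prop5ContractionKLevelSanity

open B7Prop1Explicit (e)
open B7Eq78Linearization (conjR conjR_apply)
open B8Ineq132 (covDerivFwd covDeriv)
open B8LambdaSpaceKLevel (wt lamSubK lamOf lamOf_zero ext_of_lamOf)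
open B8Prop5ContractionKLevel (Bd2 bd2_zero Mc Kc mWc KWc PsiP5 propFive_fixedPoint_kLevel)

-- `Site` alone could resolve to the torus sites of `Setup.lean`; re-export the `ℤ^d` sites of `B7Prop1Explicit`.
export B7Prop1Explicit (Site)

variable {d : ℕ} {𝔸 : Type*} [NormedRing 𝔸] [NormOneClass 𝔸] [NormedAlgebra ℂ 𝔸] [CompleteSpace 𝔸]

/-- **NON-VACUITY of `propFive_fixedPoint_kLevel`**: at the trivial datum (`G′ = R = gpar = Eterm = 0`, `D*A = 0`, `A = 0`, `b₁ = 1/140`, all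
other sizes `0`, `α₄ = 1`) every hypothesis holds and the theorem yields its unique fixed point. [cite: Balaban1985RegularSpaces, p.94 (after (1.106))] -/
theorem propFive_fixedPoint_kLevel_nonvacuous {L : ℕ} (hL : 1 ≤ L) {η : ℝ} (hη : 0 < η) (k : ℕ) (Ω : ℕ → Set (Site d))
    (Eb : ℕ → Set (Site d × Fin d)) (U₀ : Site d → Fin d → 𝔸ˣ) :
    ∃! s : lamSubK η U₀ L k Eb, ‖s‖ ≤ (1 : ℝ) / 4 ∧
      lamOf s = (fun _ => (0 : Site d → 𝔸)) (PsiP5 η U₀ (0 : Site d → Fin d → 𝔸) (0 : Site d → 𝔸) (fun _ => 0) (fun _ => 0) (fun _ => 0)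
        (lamOf s)) := by
  refine propFive_fixedPoint_kLevel (d := d) (Ω := Ω) (Eb := Eb) (U₀ := U₀) (A := 0) (DA := 0) hL hη (fun _ => 0) (fun _ => 0)
    (fun _ => 0) (fun _ => 0) (α₄ := 1) (BG := 0) (BR := 0) (a₁ := 0) (b₁ := 1 / 140) (cA := 0) (cDA := 0) (mE := 0) (KE := 0)
    (ℓ₀ := 0) (ℓ₁ := 0) zero_le_one le_rfl le_rfl le_rfl (by norm_num) (by norm_num) le_rfl le_rfl (by norm_num) le_rfl le_rfl le_rfl
    le_rfl le_rfl (by norm_num) ?_ ?_ ?_ ?_ ?_ ?_ ?_ ?_ ?_ ?_ ?_ ?_ ?_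
  · -- hG : G′ = 0
    intro f m hm _
    refine ⟨fun x => by simp, fun j hj p hp => ?_⟩
    have : covDerivFwd η U₀ p.2 ((fun _ => (0 : Site d → 𝔸)) f) p.1 = 0 := by simp [covDerivFwd, conjR_apply]
    rw [this, norm_zero, mul_zero, zero_mul]
  · intro f g; simp
  · intro f g; simp
  · intro f m hm _; rw [zero_mul]; exact bd2_zero le_rfl
  · intro s _ j _ x _; simp
  · intro s _ j _ x _ μ
    constructor <;> simp [covDerivFwd, covDeriv, conjR_apply]
  · intro s t _ _ j _ x _
    refine ⟨by simp, fun μ => ⟨?_, ?_⟩⟩ <;> simp [covDerivFwd, covDeriv, conjR_apply]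
  · intro s _; exact bd2_zero le_rfl
  · intro s t _ _; simpa using (bd2_zero (L := L) (η := η) (k := k) (Ω := Ω) (𝔸 := 𝔸) le_rfl)
  · exact bd2_zero le_rfl
  · intro j _ x _ μ
    constructor <;> simp [conjR_apply]
  · simp [Mc]
  · simp [Kc]

omit [NormOneClass 𝔸] in
/-- At the trivial datum the unique fixed point is `λ = 0`. [cite: Balaban1985RegularSpaces, p.94 (after (1.106))] -/
theorem trivial_fixedPoint_eq_zero {L : ℕ} {η : ℝ} {k : ℕ} {Eb : ℕ → Set (Site d × Fin d)}
    {U₀ : Site d → Fin d → 𝔸ˣ} {s : lamSubK η U₀ L k Eb}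
    (hfix : lamOf s = (fun _ => (0 : Site d → 𝔸)) (PsiP5 η U₀ (0 : Site d → Fin d → 𝔸) (0 : Site d → 𝔸) (fun _ => 0) (fun _ => 0)
      (fun _ => 0) (lamOf s))) : s = 0 := by
  apply ext_of_lamOf
  rw [hfix, lamOf_zero]

end Literature.MathematicalPhysics.QuantumFieldTheory.Balaban1983to89.B8Prop5ContractionKLevelSanity

end
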